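import Mathlib
import Summits.Ventures.HodgeRepro2.Tier7.Line3.HeckeWindowCounts

/-!
# Tier7/Line3/HeckeWindowSums — the §3b lattice counts in the §2c split model, II: the orbital sums and the window
(REPAIR-CENSUS §C U1; part I = Tier7/Line3/HeckeWindowCounts.lean: the valuation model `InCartan` and the solution sets
`sol l₁ l₂`)

Filer: t7-L1-p3 (gen 6, prover-pub-hodge-repro2-t7-L1-p3-g6-0), assignment = the t7-lead's l. 15499 (U1 → this seat),
TARGET line STATUS l. 15509 (one module announced; split into I/II by the gate's 400-line rule, same content). Lane: Line 3
SUPPORT, [M]-level; NOT a line, NOT a device; touches neither residual clause (a′) nor (b′) of the line.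

* (K3) THE ORBITAL SUMS. `UnramChar` = an unramified character of `T × T` (trivial on `T(O) × T(O)`, so a function
  of the valuations, `(u,m,x,y) ↦ α₁^u α₂^m β₁^x β₂^y`) trivial on `Z^Δ` (`α₁ α₂ β₁ β₂ = 1`, the memo's condition (C));
  `orbSum χ l₁ l₂ := ∑ᶠ p ∈ sol l₁ l₂, χ p` is `O_γ(1_{K ϖ^λ K}) / vol` with `vol = vol(T(O) × T(O) / Z^Δ(O))`:
  `orbSum χ 0 0 = 1`, `orbSum χ 1 0 = β₁ + β₂ + α₁⁻¹ + α₂⁻¹`, `orbSum χ 1 1 = β₁ β₂`,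
  `orbSum χ 2 1 = β₁ β₂ (β₁ + β₂ + α₁⁻¹ + α₂⁻¹)`, `orbSum χ 2 0 = β₁² + β₂² + (α₁⁻¹ + α₂⁻¹)(β₁ + β₂) + α₁⁻² + α₂⁻²`.
  THE MEASURE BRIDGE `integral_fibreConst`: on any measure space with a measurable «valuation» map `val` to `ℤ³` whose
  fibres all have the same finite measure `vol`, the integral of the function «`χ (val g)` on the fibres over a
  finite set `S`, `0` elsewhere» equals `vol · ∑_{p ∈ S} χ p` — the step «the integrand is constant on the
  valuation fibres, each of measure `vol`» of §2c, abstractly.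
* (K4) THE HECKE WINDOW. `satake_window`: for ANY linear transform with `Ŝ(1_K) = 1`, `Ŝ(1_{ϖK}) = αβ`,
  `Ŝ(T_ϖ) = κ⁻¹ (α + β)` (print: `κ = q^{−1/2}` in the unitary normalisation), the combination
  `f = 1_{ϖK} − c κ T_ϖ + c² 1_K` has `Ŝ(f) = (α − c)(β − c)`, which vanishes on every parameter containing `c`
  (`satake_window_root`). `windowOrb χ κ c := orbSum χ 1 1 − c κ · orbSum χ 1 0 + c² · orbSum χ 0 0`
  (`= O_γ(f) / vol`) equals `β₁ β₂ − c κ (β₁ + β₂ + α₁⁻¹ + α₂⁻¹) + c²`; as a polynomial in `c` (`windowPoly`) it is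
  MONIC OF DEGREE 2 — so it has at most two roots (`windowPoly_card_roots_le`, `windowOrb_zero_finite`), whatever the
  character: §3b's «a quadratic polynomial in `c` with leading coefficient `O_{γ₀}(1_K) = vol > 0`», now with the
  coefficients written out.

RECORD (honest; also in proofs/t7/L3/HECKE-WINDOW-p3.md). The coefficients `α_i, β_i` are the values at `ϖ_{v₂}` of the
unramified characters `μ_A`, `μ_B` (transported) and VARY with the auxiliary place `v₂`, together with
`c_{v₂} = χ_V⁻¹(ϖ_{v₂})`; «at most two roots» is a statement per place. The existence of a split `v₂ ∉ S` with
`O_{γ₀}(f_{v₂}) ≠ 0` is §3b's sentence on the values of finitely many Hecke characters at the places (in words; not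
claimed here). NOT in this file: that the real `U(W_A)(F_v)`, `T_A`, `T_B`, `K_v`, `γ₀ h`, `μ_A`, `μ_B` ARE the model's
objects (the dictionary, (a′)); the Satake isomorphism and its normalisation (print); the Hecke-algebra structure
constants needed to read the cubic variant's `(α+β)²` and `αβ(α+β)` (print); anything about `X`; nothing about the
step (P) is claimed. The RTF of §2, its spectral side, and the pole class are not typed here — only the local lattice
counts.

§8(d) (uses an L-value-free non-vanishing device): NO — elementary algebra of the counts.
-/

namespace Summit.Ventures.HodgeRepro2.Tier7.Line3.HeckeWindow

/-! ## K3. The orbital sums -/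

/-- (K3) An unramified character of `T × T` trivial on `Z^Δ`: `diag(t₁,t₂), diag(s₁,s₂) ↦ α₁^u α₂^m β₁^x β₂^y`
with `α₁ α₂ β₁ β₂ = 1` (the memo's condition (C): `μ_A · conj μ_B` trivial on the diagonal centre). -/
structure UnramChar where
  /-- the value of the first `T`-coordinate character at `ϖ` -/
  α₁ : ℂ
  /-- the value of the second `T`-coordinate character at `ϖ` -/
  α₂ : ℂ
  /-- the value of the first `T′`-coordinate character at `ϖ` -/
  β₁ : ℂ
  /-- the value of the second `T′`-coordinate character at `ϖ` -/
  β₂ : ℂ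
  /-- triviality on the diagonal centre -/
  central : α₁ * α₂ * β₁ * β₂ = 1

namespace UnramChar

variable (χ : UnramChar)

/-- `α₁ ≠ 0` (from `α₁ α₂ β₁ β₂ = 1`). -/
theorem α₁_ne_zero : χ.α₁ ≠ 0 := by
  intro h; have := χ.central; rw [h] at this; simp at this

/-- `α₂ ≠ 0`. -/
theorem α₂_ne_zero : χ.α₂ ≠ 0 := by
  intro h; have := χ.central; rw [h] at this; simp at this

/-- `β₁ ≠ 0`. -/
theorem β₁_ne_zero : χ.β₁ ≠ 0 := by
  intro h; have := χ.central; rw [h] at this; simp at this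

/-- `β₂ ≠ 0`. -/
theorem β₂_ne_zero : χ.β₂ ≠ 0 := by
  intro h; have := χ.central; rw [h] at this; simp at this

/-- The value on the valuation quadruple `(u, m, x, y)`. -/
noncomputable def val (u m x y : ℤ) : ℂ := χ.α₁ ^ u * χ.α₂ ^ m * χ.β₁ ^ x * χ.β₂ ^ y

/-- Triviality on `Z^Δ`: the value is invariant under `(u,m,x,y) ↦ (u+k,m+k,x+k,y+k)`. -/
theorem val_shift (u m x y k : ℤ) : χ.val (u + k) (m + k) (x + k) (y + k) = χ.val u m x y := by
  unfold val
  rw [zpow_add₀ χ.α₁_ne_zero, zpow_add₀ χ.α₂_ne_zero, zpow_add₀ χ.β₁_ne_zero, zpow_add₀ χ.β₂_ne_zero]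
  have h : (χ.α₁ * χ.α₂ * χ.β₁ * χ.β₂) ^ k = 1 := by rw [χ.central, one_zpow]
  rw [mul_zpow, mul_zpow, mul_zpow] at h
  linear_combination (χ.α₁ ^ u * χ.α₂ ^ m * χ.β₁ ^ x * χ.β₂ ^ y) * h

/-- The value on a normalised triple `(m, x, y)` (`u = 0`). -/
noncomputable def val₀ (p : ℤ × ℤ × ℤ) : ℂ := χ.val 0 p.1 p.2.1 p.2.2

/-- `α₂ β₁ β₂ = α₁⁻¹` (triviality on `Z^Δ`). -/
theorem α₂_mul_β₁_mul_β₂ : χ.α₂ * χ.β₁ * χ.β₂ = χ.α₁⁻¹ := by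
  have h := χ.central
  have hα₁ := χ.α₁_ne_zero
  field_simp
  linear_combination h

end UnramChar

/-- (K3) The orbital sum `O_γ(1_{K ϖ^λ K}) / vol`: the character summed over the solution set. -/
noncomputable def orbSum (χ : UnramChar) (l₁ l₂ : ℤ) : ℂ := ∑ᶠ p ∈ sol l₁ l₂, χ.val₀ p

section OrbSumValues

variable (χ : UnramChar)

/-- (K3) `O_γ(1_K) / vol = 1`: the single coset `(0,0,0)` with character value `1` (§2c). -/
theorem orbSum_zero_zero : orbSum χ 0 0 = 1 := by
  unfold orbSum
  rw [sol_zero_zero, finsum_mem_singleton]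
  simp [UnramChar.val₀, UnramChar.val]

/-- (K3) `O_γ(T_ϖ) / vol = β₁ + β₂ + α₁⁻¹ + α₂⁻¹`: the four cosets `(0,0,1), (0,1,0), (1,1,1), (−1,0,0)`
contribute `β₂, β₁, α₂ β₁ β₂ = α₁⁻¹, α₂⁻¹`. -/
theorem orbSum_one_zero : orbSum χ 1 0 = χ.β₁ + χ.β₂ + χ.α₁⁻¹ + χ.α₂⁻¹ := by
  unfold orbSum
  rw [sol_one_zero]
  rw [show ({(0, 0, 1), (0, 1, 0), (1, 1, 1), (-1, 0, 0)} : Set (ℤ × ℤ × ℤ)) =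
      ↑({(0, 0, 1), (0, 1, 0), (1, 1, 1), (-1, 0, 0)} : Finset (ℤ × ℤ × ℤ)) by simp]
  rw [finsum_mem_coe_finset]
  rw [Finset.sum_insert (by decide), Finset.sum_insert (by decide), Finset.sum_insert (by decide),
    Finset.sum_singleton]
  have h := χ.α₂_mul_β₁_mul_β₂
  simp only [UnramChar.val₀, UnramChar.val, zpow_zero, zpow_one, zpow_neg, one_mul, mul_one]
  linear_combination h

/-- (K3) `O_γ(1_{ϖ K}) / vol = β₁ β₂`: the single coset `(0,1,1)`. -/
theorem orbSum_one_one : orbSum χ 1 1 = χ.β₁ * χ.β₂ := by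
  unfold orbSum
  rw [sol_one_one, finsum_mem_singleton]
  simp [UnramChar.val₀, UnramChar.val]

/-- (K3) `O_γ(1_{ϖ K diag(ϖ,1) K}) / vol = β₁ β₂ (β₁ + β₂ + α₁⁻¹ + α₂⁻¹)` (the central translate of `T_ϖ`). -/
theorem orbSum_two_one : orbSum χ 2 1 = χ.β₁ * χ.β₂ * (χ.β₁ + χ.β₂ + χ.α₁⁻¹ + χ.α₂⁻¹) := by
  unfold orbSum
  rw [sol_two_one]
  rw [show ({(0, 1, 2), (0, 2, 1), (1, 2, 2), (-1, 1, 1)} : Set (ℤ × ℤ × ℤ)) =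
      ↑({(0, 1, 2), (0, 2, 1), (1, 2, 2), (-1, 1, 1)} : Finset (ℤ × ℤ × ℤ)) by simp]
  rw [finsum_mem_coe_finset]
  rw [Finset.sum_insert (by decide), Finset.sum_insert (by decide), Finset.sum_insert (by decide),
    Finset.sum_singleton]
  have h := χ.α₂_mul_β₁_mul_β₂
  simp only [UnramChar.val₀, UnramChar.val, zpow_neg, zpow_ofNat]
  linear_combination (χ.β₁ * χ.β₂) * h

/-- (K3) `O_γ(1_{K diag(ϖ²,1) K}) / vol = β₁² + β₂² + (α₁⁻¹ + α₂⁻¹)(β₁ + β₂) + α₁⁻² + α₂⁻²`: the eight cosets. -/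
theorem orbSum_two_zero :
    orbSum χ 2 0 = χ.β₁ ^ 2 + χ.β₂ ^ 2 + (χ.α₁⁻¹ + χ.α₂⁻¹) * (χ.β₁ + χ.β₂) + χ.α₁⁻¹ ^ 2 + χ.α₂⁻¹ ^ 2 := by
  unfold orbSum
  rw [sol_two_zero]
  rw [show ({(0, 0, 2), (0, 2, 0), (1, 1, 2), (1, 2, 1), (2, 2, 2), (-1, 0, 1), (-1, 1, 0), (-2, 0, 0)} :
      Set (ℤ × ℤ × ℤ)) =
      ↑({(0, 0, 2), (0, 2, 0), (1, 1, 2), (1, 2, 1), (2, 2, 2), (-1, 0, 1), (-1, 1, 0), (-2, 0, 0)} :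
      Finset (ℤ × ℤ × ℤ)) by simp]
  rw [finsum_mem_coe_finset]
  rw [Finset.sum_insert (by decide), Finset.sum_insert (by decide), Finset.sum_insert (by decide),
    Finset.sum_insert (by decide), Finset.sum_insert (by decide), Finset.sum_insert (by decide),
    Finset.sum_insert (by decide), Finset.sum_singleton]
  have h := χ.α₂_mul_β₁_mul_β₂
  simp only [UnramChar.val₀, UnramChar.val, zpow_neg, zpow_ofNat]
  linear_combination (χ.β₁ + χ.β₂ + χ.α₂ * χ.β₁ * χ.β₂ + χ.α₁⁻¹) * h

end OrbSumValues

/-! ### The measure bridge: integral of a fibre-constant function = `vol × finite sum` -/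

section MeasureBridge

open MeasureTheory

variable {G : Type*} [MeasurableSpace G] (μ : Measure G) (val : G → ℤ × ℤ × ℤ)

open scoped Classical in
/-- The integrand of the orbital integral in the model: the character of the valuation triple on the fibres over
`S`, `0` elsewhere (`f(t⁻¹ γ s) · χ(t, s)` with `f = 1_{K ϖ^λ K}`, `S = sol λ`). -/
noncomputable def fibreConst (S : Set (ℤ × ℤ × ℤ)) (c : ℤ × ℤ × ℤ → ℂ) (g : G) : ℂ :=
  if val g ∈ S then c (val g) else 0

omit [MeasurableSpace G] in
/-- The fibre-constant function is the finite sum of the indicators of the fibres over `S`, weighted by `c`. -/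
theorem fibreConst_eq_sum (S : Finset (ℤ × ℤ × ℤ)) (c : ℤ × ℤ × ℤ → ℂ) (g : G) :
    fibreConst val (↑S) c g = ∑ p ∈ S, (val ⁻¹' {p}).indicator (fun _ => c p) g := by
  unfold fibreConst
  by_cases hg : val g ∈ S
  · rw [if_pos (Finset.mem_coe.mpr hg), Finset.sum_eq_single (val g)]
    · simp
    · intro p _ hp
      simp [Ne.symm hp]
    · intro h; exact absurd hg h
  · rw [if_neg (fun h => hg (Finset.mem_coe.mp h))]
    symm
    apply Finset.sum_eq_zero
    intro p hp
    have : val g ≠ p := fun h => hg (by rw [h]; exact hp)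
    simp [this]

/-- (K3) THE MEASURE BRIDGE: if every valuation fibre has the same finite measure `vol`, the integral of the
fibre-constant function over a finite solution set `S` is `vol · ∑_{p ∈ S} c p` — the step «each coset has measure
`vol(T(O) × T(O) / Z^Δ(O))` and the integrand is constant on it» of §2c. -/
theorem integral_fibreConst (hval : Measurable val) (S : Finset (ℤ × ℤ × ℤ)) (c : ℤ × ℤ × ℤ → ℂ)
    (vol : ENNReal) (hvol : vol ≠ ⊤) (hfib : ∀ p, μ (val ⁻¹' {p}) = vol) :
    ∫ g, fibreConst val (↑S) c g ∂μ = vol.toReal • ∑ p ∈ S, c p := by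
  have hmeas : ∀ p : ℤ × ℤ × ℤ, MeasurableSet (val ⁻¹' {p}) := fun p =>
    hval (measurableSet_singleton p)
  calc ∫ g, fibreConst val (↑S) c g ∂μ
      = ∫ g, ∑ p ∈ S, (val ⁻¹' {p}).indicator (fun _ => c p) g ∂μ := by
        congr 1; ext g; exact fibreConst_eq_sum val S c g
    _ = ∑ p ∈ S, ∫ g, (val ⁻¹' {p}).indicator (fun _ => c p) g ∂μ := by
        apply integral_finsetSum
        intro p _
        rw [integrable_indicator_iff (hmeas p)]
        exact integrableOn_const (by rw [hfib p]; exact hvol)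
    _ = ∑ p ∈ S, μ.real (val ⁻¹' {p}) • c p := by
        refine Finset.sum_congr rfl fun p _ => ?_
        exact integral_indicator_const (c p) (hmeas p)
    _ = vol.toReal • ∑ p ∈ S, c p := by
        rw [Finset.smul_sum]
        refine Finset.sum_congr rfl fun p _ => ?_
        rw [measureReal_def, hfib p]

end MeasureBridge

/-! ## K4. The Hecke window -/

/-- (K4) For any linear transform `Ŝ` with `Ŝ(1_K) = 1`, `Ŝ(1_{ϖK}) = αβ`, `Ŝ(T_ϖ) = κ⁻¹ (α + β)` (print:
`κ = q^{−1/2}` in the unitary normalisation), the window `f = 1_{ϖK} − c κ T_ϖ + c² 1_K` has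
`Ŝ(f) = (α − c)(β − c)`. -/
theorem satake_window (S₁ Sϖ ST α β c κ : ℂ) (hκ : κ ≠ 0) (h₁ : S₁ = 1) (hϖ : Sϖ = α * β)
    (hT : ST = κ⁻¹ * (α + β)) :
    Sϖ - c * κ * ST + c ^ 2 * S₁ = (α - c) * (β - c) := by
  subst h₁ hϖ hT
  field_simp
  ring

/-- (K4) The window kills every unramified parameter `{α, β}` containing `c`. -/
theorem satake_window_root (α β c : ℂ) (h : α = c ∨ β = c) : (α - c) * (β - c) = 0 := by
  rcases h with h | h <;> simp [h]

/-- (K4) `O_γ(f) / vol` for the window `f = 1_{ϖK} − c κ T_ϖ + c² 1_K`. -/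
noncomputable def windowOrb (χ : UnramChar) (κ c : ℂ) : ℂ :=
  orbSum χ 1 1 - c * κ * orbSum χ 1 0 + c ^ 2 * orbSum χ 0 0

/-- (K4) The window's orbital sum written out: `β₁ β₂ − c κ (β₁ + β₂ + α₁⁻¹ + α₂⁻¹) + c²`. -/
theorem windowOrb_eq (χ : UnramChar) (κ c : ℂ) :
    windowOrb χ κ c = χ.β₁ * χ.β₂ - c * κ * (χ.β₁ + χ.β₂ + χ.α₁⁻¹ + χ.α₂⁻¹) + c ^ 2 := by
  unfold windowOrb
  rw [orbSum_one_one, orbSum_one_zero, orbSum_zero_zero, mul_one]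

open Polynomial in
/-- (K4) The window's orbital sum as a polynomial in `c`: `X² − κ (β₁ + β₂ + α₁⁻¹ + α₂⁻¹) X + β₁ β₂`. -/
noncomputable def windowPoly (χ : UnramChar) (κ : ℂ) : ℂ[X] :=
  C (1 : ℂ) * X ^ 2 + C (-(κ * (χ.β₁ + χ.β₂ + χ.α₁⁻¹ + χ.α₂⁻¹))) * X + C (χ.β₁ * χ.β₂)

open Polynomial in
/-- (K4) `windowPoly` evaluated at `c` is `windowOrb χ κ c`. -/
theorem windowPoly_eval (χ : UnramChar) (κ c : ℂ) : (windowPoly χ κ).eval c = windowOrb χ κ c := by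
  rw [windowOrb_eq]
  simp only [windowPoly, eval_add, eval_mul, eval_C, eval_pow, eval_X]
  ring

open Polynomial in
/-- (K4) The window polynomial is monic of degree exactly `2` — §3b's «leading coefficient `O_{γ₀}(1_K) = vol > 0`». -/
theorem windowPoly_natDegree (χ : UnramChar) (κ : ℂ) : (windowPoly χ κ).natDegree = 2 := by
  unfold windowPoly
  exact natDegree_quadratic one_ne_zero

open Polynomial in
/-- (K4) The window polynomial is not the zero polynomial. -/
theorem windowPoly_ne_zero (χ : UnramChar) (κ : ℂ) : windowPoly χ κ ≠ 0 := by
  intro h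
  have := windowPoly_natDegree χ κ
  rw [h, natDegree_zero] at this
  exact absurd this (by norm_num)

open Polynomial in
/-- (K4) At most two roots. -/
theorem windowPoly_card_roots_le (χ : UnramChar) (κ : ℂ) : (windowPoly χ κ).roots.card ≤ 2 :=
  (card_roots' _).trans (windowPoly_natDegree χ κ).le

open Polynomial in
/-- (K4) The set of `c` with `O_γ(f) = 0` is finite, of at most two elements — for every unramified character and
every normalisation `κ` (no condition on the datum). With `vol ≠ 0` this is the zero set of `vol · windowOrb`. -/
theorem windowOrb_zero_finite (χ : UnramChar) (κ : ℂ) :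
    {c : ℂ | windowOrb χ κ c = 0}.Finite ∧ {c : ℂ | windowOrb χ κ c = 0}.ncard ≤ 2 := by
  have hset : {c : ℂ | windowOrb χ κ c = 0} = ↑(windowPoly χ κ).roots.toFinset := by
    ext c
    simp only [Set.mem_setOf_eq, Finset.mem_coe, Multiset.mem_toFinset,
      mem_roots (windowPoly_ne_zero χ κ), IsRoot.def, windowPoly_eval]
  rw [hset]
  refine ⟨Finset.finite_toSet _, ?_⟩
  rw [Set.ncard_coe_finset]
  exact (Multiset.toFinset_card_le _).trans (windowPoly_card_roots_le χ κ)

/-- (K4) With the volume factor: `vol · windowOrb` vanishes for at most two values of `c` when `vol ≠ 0`. -/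
theorem vol_mul_windowOrb_zero_finite (χ : UnramChar) (κ : ℂ) (vol : ℂ) (hvol : vol ≠ 0) :
    {c : ℂ | vol * windowOrb χ κ c = 0}.Finite ∧ {c : ℂ | vol * windowOrb χ κ c = 0}.ncard ≤ 2 := by
  have h : {c : ℂ | vol * windowOrb χ κ c = 0} = {c : ℂ | windowOrb χ κ c = 0} := by
    ext c; simp [hvol]
  rw [h]
  exact windowOrb_zero_finite χ κ

end Summit.Ventures.HodgeRepro2.Tier7.Line3.HeckeWindow
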